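import Literature.MathematicalPhysics.QuantumFieldTheory.Balaban1983to89.BlockAveragingEMLAnalyticMean
import Summits.QuantumFields.BalabanUV.T4Continuum.Support.SubstrateAvgTowerStructure

/-!
# B13AvgCorrEml — row NE5, κ-DISCHARGE programme (T4-DAG §8 Q49 (a′), dagwriter l.23165; owner's design note
# `HOME/t4/b2b-balaban-t4-ne5-p1/g39/KAPPA-NE5-DESIGN.md` v0.1 §3), leaf κ-L4 «EML ON THE GUARD»: A UNIFORM BOUND ON THE (0.4) LOOP
# VARIABLES IS A BOUND ON THE CORRECTION FACTOR — `∀ i, dist1 (loopHol U c i) ≤ ρ ⟹ dist1 (corr expMeanLogSU U c) ≤ ρ∕(1 − ρ) ≤ (3∕2)·ρ`,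
# WITH NO THRESHOLD ON `ρ` (off the small-field guard `corr = 1`; on it every loop variable is within `δ_N ≤ 1∕3` of `1`)

Cell `pub-balaban`, unit `b2b-balaban-t4-ne5-formalise-leaf-06` (NE5 formalisation swarm, leaf prover 06, gen 20; CLAIM κ-L4 journal l.23610).
Summits-side NEW WORK under the LEAN PLACEMENT RULE: [folklore] Banach-algebra ∕ matrix analysis on OUR objects `ExpMeanLog.eml`,
`ExpMeanLog.expMeanLogSU`, `BlockAveraging.Small ∕ corr ∕ loopHol`, `SubstrateAvgTowerStructure.avgTower`; 0 `def`, no `Prop`-valued fact minted,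
nothing printed asserted, no citation tag.  HONEST FRAMING: rung (B)+1 of the FINITE-VOLUME T⁴ programme — NOT infinite volume, NOT a mass gap,
NOT the Clay problem, NOT a proof of NE5 (NOT PRINTED; GAPS G-t4-U3-1); nothing of [Balaban1985Averaging] ∕ [Balaban1987RG1] is instantiated or
discharged — the (0.4) loop-variable bound `ρ` (leaves κ-L1∕κ-L2∕κ-L3: torus Stokes × finest plaquettes × refined-loop identity) stays a DISPLAYED
hypothesis of every theorem below.  HONEST DEPENDENCY (cell, verbatim): continuum YM on T⁴ ⇐ BetaPertH ∧ nine spine estimates (0/9 proved);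
BetaPertH ⇐ (D1) ∧ (D4) ∧ CAP+tail; G-an2-4 gates asym, D1 and NE2/3/4.

WHY.  The κ-letter displayed by the substrate's W-25a∕b (`hκ : ∀ i < K, ∀ c, dist1 (corr ℰ (avgTower ℰ V i) c) ≤ κ∕(L^(K−1−i))²`,
`SubstrateAvgTowerStructure.dist1_corrAcc_le_of_hκ`; GAPS § G-ne5p1-Javg-reg) is discharged for the PRINTED small-loop average `ℰ = expMeanLogSU`
on the owner's road (design note §2) in two moves: (K1) every loop variable `loopHol U_i c idx` of (0.4) is within `κ₀∕ℓ²` of `1` (κ-L1–L3, κ-END's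
induction), and (K2)+(K3) = THIS FILE: such a bound puts the family on the small-field guard once `κ₀∕ℓ² < δ_N` (K2) and, on the guard,
`corr = exp[mean log]` is within `ρ∕(1 − ρ)` of `1` (K3: (26) `‖log W‖ ≤ −log(1 − ‖W − 1‖)` termwise, the mean does not increase the sup norm,
`‖e^Z − 1‖ ≤ e^{‖Z‖} − 1`).  Because the total extension `corr` is `1` OFF the guard and the guard radius is `δ_N = min(1∕3, π∕N) ≤ 1∕3`, the
correction-factor bound needs NO threshold on `ρ` at all: `dist1 (corr expMeanLogSU U c) ≤ (3∕2)·ρ` for every `ρ` dominating the loop variables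
(§3) — so κ-END's constant is `κ = (3∕2)·κ₀` (sharper than the design's «2e^{1∕4}») and its smallness conditions concern (K1) only.

WHAT (0 def, [folklore] throughout).
* §1 (any complete normed `ℂ`-algebra; the CLOSED-polydisc twin of `BlockAveragingEMLAnalyticMean.norm_eml_sub_one_le`):
  `norm_eml_sub_one_le_of_le` (`0 ≤ ρ < 1`, `∀ i, ‖U i − 1‖ ≤ ρ` ⟹ `‖eml U − 1‖ ≤ ρ∕(1 − ρ)`), the arithmetic `div_one_sub_le_three_halves_mul`
  (`ρ ≤ 1∕3 ⟹ ρ∕(1 − ρ) ≤ (3∕2)ρ`) ∕ `div_one_sub_le_two_mul` (`ρ ≤ 1∕2 ⟹ … ≤ 2ρ`), and `norm_eml_sub_one_le_three_halves_mul`.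
* §2 (`SU(N)`, `dist1 = ‖· − 1‖_{op}` by `rfl`): `dist1_E_le_div` ∕ `dist1_E_le_three_halves_mul` for `expMeanLogSU.E` on the guard (arity
  `Fin (m+1)`), `dist1_avg_le_div` ∕ `dist1_avg_le_three_halves_mul` for `expMeanLogSU.avg` over any nonempty finite index type.
* §3 (`BlockAveraging`, fine level `j`, coarse bond `c`): (K2) `small_of_le` (`∀ i, dist1 (loopHol U c i) ≤ ρ`, `ρ < δ_N` ⟹ `Small expMeanLogSU U c`);
  the ℰ-generic guard splitter `dist1_corr_le_of_small_imp`; (K3) `dist1_corr_le_div` (`ρ < 1` ⟹ `dist1 (corr expMeanLogSU U c) ≤ ρ∕(1 − ρ)`) and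
  the THRESHOLD-FREE END **`dist1_corr_le_three_halves_mul : (∀ i, dist1 (loopHol U c i) ≤ ρ) → dist1 (corr expMeanLogSU U c) ≤ 3∕2 * ρ`**.
* §4 (W-25b's display shape, one `exact` for κ-END): **`hκ_of_loopHol_le`**: from
  `∀ i < P.K, ∀ c idx, dist1 (loopHol (avgTower expMeanLogSU V i) c idx) ≤ κ₀ ∕ ((P.L:ℝ)^(P.K−1−i))²` conclude
  `∀ i < P.K, ∀ c, dist1 (corr expMeanLogSU (avgTower expMeanLogSU V i) c) ≤ (3∕2 * κ₀) ∕ ((P.L:ℝ)^(P.K−1−i))²` — the substrate's `hκ` with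
  `κ := 3∕2 * κ₀`; and the level-generic `dist1_corr_scaled_le` behind it.
Inputs BY NAME: `MatrixLog.norm_mlog_le_neg_log`, `B7TransferAnalyticMean.norm_meanCLM_apply_le ∕ norm_exp_sub_one_le`,
`BlockAveragingEMLAnalyticMean.eml_eq_exp_meanCLM ∕ coe_expMeanLogSU_E_eq_eml`, `ExpMeanLog.lt_third_of_lt_deltaSU`.
0 sorry; axioms ⊆ {propext, Classical.choice, Quot.sound}.
-/

noncomputable section

open scoped BigOperators

namespace Summit.QuantumFields.BalabanUV.T4Continuum.B13AvgCorrEml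

open NormedSpace
open Literature.MathematicalPhysics.QuantumFieldTheory.Balaban1983to89
open Literature.MathematicalPhysics.QuantumFieldTheory.Balaban1983to89.MatrixLog (mlog norm_mlog_le_neg_log)
open Literature.MathematicalPhysics.QuantumFieldTheory.Balaban1983to89.B7TransferAnalyticMean
  (meanCLM norm_meanCLM_apply_le norm_exp_sub_one_le)
open Literature.MathematicalPhysics.QuantumFieldTheory.Balaban1983to89.ExpMeanLog
  (eml deltaSU deltaSU_pos expMeanLogSU lt_third_of_lt_deltaSU)
open Literature.MathematicalPhysics.QuantumFieldTheory.Balaban1983to89.BlockAveragingEMLAnalyticMean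
  (eml_eq_exp_meanCLM coe_expMeanLogSU_E_eq_eml)

/-! ## §1 The closed-polydisc form of «the average is close to the identity» for `eml` -/

section Generic

variable {ι : Type*} [Fintype ι] {𝔸 : Type*} [NormedRing 𝔸] [NormedAlgebra ℂ 𝔸] [CompleteSpace 𝔸]

/-- [folklore] **`eml` ON THE CLOSED POLYDISC**: if every component satisfies `‖U i − 1‖ ≤ ρ` with `0 ≤ ρ < 1`, then
`‖eml U − 1‖ ≤ ρ∕(1 − ρ)` — (26) `‖log U_i‖ ≤ −log(1 − ρ)` for each component, the arithmetic mean does not increase the sup norm,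
and `‖e^Z − 1‖ ≤ e^{‖Z‖} − 1 = ρ∕(1 − ρ)`.  (The open-polydisc form is `BlockAveragingEMLAnalyticMean.norm_eml_sub_one_le`.) -/
theorem norm_eml_sub_one_le_of_le {ρ : ℝ} (hρ0 : 0 ≤ ρ) (hρ1 : ρ < 1) {U : ι → 𝔸} (hU : ∀ i, ‖U i - 1‖ ≤ ρ) :
    ‖eml U - 1‖ ≤ ρ / (1 - ρ) := by
  have hlog0 : 0 ≤ -Real.log (1 - ρ) := by
    have : Real.log (1 - ρ) ≤ 0 := Real.log_nonpos (by linarith) (by linarith)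
    linarith
  have hZ : ‖meanCLM ι 𝔸 (fun j => mlog (U j))‖ ≤ -Real.log (1 - ρ) := by
    refine (norm_meanCLM_apply_le _).trans ((pi_norm_le_iff_of_nonneg hlog0).2 fun j => ?_)
    refine (norm_mlog_le_neg_log ((hU j).trans_lt hρ1)).trans (neg_le_neg (Real.log_le_log (by linarith) ?_))
    linarith [hU j]
  rw [eml_eq_exp_meanCLM]
  calc ‖exp (meanCLM ι 𝔸 fun j => mlog (U j)) - 1‖
      ≤ Real.exp ‖meanCLM ι 𝔸 fun j => mlog (U j)‖ - 1 := norm_exp_sub_one_le _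
    _ ≤ Real.exp (-Real.log (1 - ρ)) - 1 := by gcongr
    _ = ρ / (1 - ρ) := by
        have h1 : 1 - ρ ≠ 0 := by linarith
        rw [Real.exp_neg, Real.exp_log (by linarith)]
        field_simp
        ring

end Generic

/-- [folklore] arithmetic: `ρ∕(1 − ρ) ≤ (3∕2)·ρ` for `0 ≤ ρ ≤ 1∕3`. -/
theorem div_one_sub_le_three_halves_mul {ρ : ℝ} (hρ0 : 0 ≤ ρ) (hρ : ρ ≤ 1 / 3) : ρ / (1 - ρ) ≤ 3 / 2 * ρ := by
  rw [div_le_iff₀ (by linarith)]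
  nlinarith

/-- [folklore] arithmetic: `ρ∕(1 − ρ) ≤ 2ρ` for `0 ≤ ρ ≤ 1∕2`. -/
theorem div_one_sub_le_two_mul {ρ : ℝ} (hρ0 : 0 ≤ ρ) (hρ : ρ ≤ 1 / 2) : ρ / (1 - ρ) ≤ 2 * ρ := by
  rw [div_le_iff₀ (by linarith)]
  nlinarith

section GenericLinear

variable {ι : Type*} [Fintype ι] {𝔸 : Type*} [NormedRing 𝔸] [NormedAlgebra ℂ 𝔸] [CompleteSpace 𝔸]

/-- [folklore] the LINEAR form on the polydisc of radius `1∕3` (the radius of the small-loop averages of the tree):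
`∀ i, ‖U i − 1‖ ≤ ρ ≤ 1∕3 ⟹ ‖eml U − 1‖ ≤ (3∕2)·ρ`. -/
theorem norm_eml_sub_one_le_three_halves_mul {ρ : ℝ} (hρ0 : 0 ≤ ρ) (hρ : ρ ≤ 1 / 3) {U : ι → 𝔸}
    (hU : ∀ i, ‖U i - 1‖ ≤ ρ) : ‖eml U - 1‖ ≤ 3 / 2 * ρ :=
  (norm_eml_sub_one_le_of_le hρ0 (by linarith) hU).trans (div_one_sub_le_three_halves_mul hρ0 hρ)

end GenericLinear

/-! ## §2 The printed `SU(N)` small-loop average on its guard -/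

section SUN

open scoped Matrix.Norms.L2Operator

variable {n : Type*} [Fintype n] [DecidableEq n] [Nonempty n]

/-- [folklore] **(K3) FOR `expMeanLogSU.E`**: on the guard `∀ i, dist1 (W i) < δ_N`, a bound `∀ i, dist1 (W i) ≤ ρ` with `ρ < 1` gives
`dist1 (expMeanLogSU.E W) ≤ ρ∕(1 − ρ)` (`dist1 = ‖· − 1‖_{op}` by `rfl`, `E W = eml W` on the guard). -/
theorem dist1_E_le_div {m : ℕ} (W : Fin (m + 1) → Matrix.specialUnitaryGroup n ℂ)
    (hW : ∀ i, dist1 (W i) < deltaSU n) {ρ : ℝ} (hρ1 : ρ < 1) (hWρ : ∀ i, dist1 (W i) ≤ ρ) :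
    dist1 ((expMeanLogSU (n := n)).E W) ≤ ρ / (1 - ρ) := by
  have hρ0 : 0 ≤ ρ := (GaugeGroup.dist1_nonneg _).trans (hWρ 0)
  show ‖(((expMeanLogSU (n := n)).E W : Matrix.specialUnitaryGroup n ℂ) : Matrix n n ℂ) - 1‖ ≤ ρ / (1 - ρ)
  rw [coe_expMeanLogSU_E_eq_eml W hW]
  exact norm_eml_sub_one_le_of_le hρ0 hρ1 fun i => hWρ i

/-- [folklore] **(K3), LINEAR AND THRESHOLD-FREE IN `ρ`**: on the guard, `∀ i, dist1 (W i) ≤ ρ ⟹ dist1 (expMeanLogSU.E W) ≤ (3∕2)·ρ`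
(apply the previous bound with `min ρ (1∕3)`, legitimate because `δ_N ≤ 1∕3`). -/
theorem dist1_E_le_three_halves_mul {m : ℕ} (W : Fin (m + 1) → Matrix.specialUnitaryGroup n ℂ)
    (hW : ∀ i, dist1 (W i) < deltaSU n) {ρ : ℝ} (hWρ : ∀ i, dist1 (W i) ≤ ρ) :
    dist1 ((expMeanLogSU (n := n)).E W) ≤ 3 / 2 * ρ := by
  have hρ0 : 0 ≤ ρ := (GaugeGroup.dist1_nonneg _).trans (hWρ 0)
  have hmin : ∀ i, dist1 (W i) ≤ min ρ (1 / 3) := fun i => le_min (hWρ i) (lt_third_of_lt_deltaSU (hW i)).le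
  have h0 : 0 ≤ min ρ (1 / 3) := le_min hρ0 (by norm_num)
  calc dist1 ((expMeanLogSU (n := n)).E W) ≤ min ρ (1 / 3) / (1 - min ρ (1 / 3)) :=
        dist1_E_le_div W hW (lt_of_le_of_lt (min_le_right _ _) (by norm_num)) hmin
    _ ≤ 3 / 2 * min ρ (1 / 3) := div_one_sub_le_three_halves_mul h0 (min_le_right _ _)
    _ ≤ 3 / 2 * ρ := by gcongr; exact min_le_left _ _

/-- [folklore] (K3) with the guard as the only hypothesis on the radius: `∀ i, dist1 (W i) ≤ ρ < δ_N ⟹ dist1 (E W) ≤ ρ∕(1 − ρ)`. -/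
theorem dist1_E_le_div_of_lt_deltaSU {m : ℕ} (W : Fin (m + 1) → Matrix.specialUnitaryGroup n ℂ)
    {ρ : ℝ} (hρ : ρ < deltaSU n) (hWρ : ∀ i, dist1 (W i) ≤ ρ) :
    dist1 ((expMeanLogSU (n := n)).E W) ≤ ρ / (1 - ρ) :=
  dist1_E_le_div W (fun i => (hWρ i).trans_lt hρ) ((lt_third_of_lt_deltaSU hρ).trans (by norm_num)) hWρ

variable {ι : Type*} [Fintype ι] [Nonempty ι]

/-- [folklore] (K3) for the average over an arbitrary nonempty finite index type (`LoopAverage.avg` = `E` after the fixed enumeration):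
on the guard, `∀ i, dist1 (W i) ≤ ρ < 1 ⟹ dist1 (expMeanLogSU.avg W) ≤ ρ∕(1 − ρ)`. -/
theorem dist1_avg_le_div (W : ι → Matrix.specialUnitaryGroup n ℂ) (hW : ∀ i, dist1 (W i) < deltaSU n)
    {ρ : ℝ} (hρ1 : ρ < 1) (hWρ : ∀ i, dist1 (W i) ≤ ρ) :
    dist1 ((expMeanLogSU (n := n)).avg W) ≤ ρ / (1 - ρ) := by
  unfold LoopAverage.avg
  exact dist1_E_le_div _ (fun i => hW _) hρ1 fun i => hWρ _

/-- [folklore] (K3), threshold-free, for the average over an arbitrary nonempty finite index type: on the guard,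
`∀ i, dist1 (W i) ≤ ρ ⟹ dist1 (expMeanLogSU.avg W) ≤ (3∕2)·ρ`. -/
theorem dist1_avg_le_three_halves_mul (W : ι → Matrix.specialUnitaryGroup n ℂ) (hW : ∀ i, dist1 (W i) < deltaSU n)
    {ρ : ℝ} (hWρ : ∀ i, dist1 (W i) ≤ ρ) :
    dist1 ((expMeanLogSU (n := n)).avg W) ≤ 3 / 2 * ρ := by
  unfold LoopAverage.avg
  exact dist1_E_le_three_halves_mul _ (fun i => hW _) fun i => hWρ _

end SUN

/-! ## §3 At the block-averaging step: the guard (K2) and the correction factor (K3) -/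

section Block

open scoped Matrix.Norms.L2Operator
open Literature.MathematicalPhysics.QuantumFieldTheory.Balaban1983to89.BlockAveraging (Idx loopHol Small corr)

variable {P : Params} {j : ℕ}

/-- [folklore] **THE GUARD SPLITTER** (any small-loop average `ℰ`): a bound `B ≥ 0` on `dist1 (ℰ.avg (loopHol U c))` valid ON the small-field
guard is a bound on the correction factor `corr ℰ U c` everywhere — off the guard `corr = 1` and `dist1 1 = 0`. -/
theorem dist1_corr_le_of_small_imp {G : Type*} [GaugeGroup G] (ℰ : LoopAverage G) (U : GaugeField P j G) (c : PBond P (j + 1))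
    {B : ℝ} (hB : 0 ≤ B) (h : Small ℰ U c → dist1 (ℰ.avg (loopHol U c)) ≤ B) : dist1 (corr ℰ U c) ≤ B := by
  unfold corr
  split_ifs with hs
  · exact h hs
  · rw [GaugeGroup.dist1_one]; exact hB

variable {n : Type*} [Fintype n] [DecidableEq n] [Nonempty n]

/-- [folklore] **(K2) THE GUARD FROM A UNIFORM LOOP BOUND**: if every (0.4) loop variable at `c` satisfies `dist1 ≤ ρ` with `ρ < δ_N`, the
family is on the small-field domain `Small expMeanLogSU U c` (so `corr` IS the printed `exp[mean log]` there). -/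
theorem small_of_le (U : GaugeField P j (Matrix.specialUnitaryGroup n ℂ)) (c : PBond P (j + 1)) {ρ : ℝ}
    (h : ∀ i, dist1 (loopHol U c i) ≤ ρ) (hρ : ρ < deltaSU n) : Small (expMeanLogSU (n := n)) U c :=
  fun i => (h i).trans_lt hρ

/-- [folklore] **(K3) AT THE STEP**: `∀ i, dist1 (loopHol U c i) ≤ ρ` with `ρ < 1` gives `dist1 (corr expMeanLogSU U c) ≤ ρ∕(1 − ρ)` — on the
guard by §2, off it because `corr = 1`.  No relation between `ρ` and `δ_N` is needed. -/
theorem dist1_corr_le_div (U : GaugeField P j (Matrix.specialUnitaryGroup n ℂ)) (c : PBond P (j + 1)) {ρ : ℝ} (hρ1 : ρ < 1)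
    (h : ∀ i, dist1 (loopHol U c i) ≤ ρ) : dist1 (corr (expMeanLogSU (n := n)) U c) ≤ ρ / (1 - ρ) := by
  have hρ0 : 0 ≤ ρ := (GaugeGroup.dist1_nonneg _).trans (h (Classical.arbitrary (Idx P)))
  refine dist1_corr_le_of_small_imp _ U c (div_nonneg hρ0 (by linarith)) fun hs => ?_
  exact dist1_avg_le_div _ hs hρ1 h

/-- [folklore] **(K3) AT THE STEP, THRESHOLD-FREE — THE END OF LEAF κ-L4**: for EVERY `ρ`,
`(∀ i, dist1 (loopHol U c i) ≤ ρ) ⟹ dist1 (corr expMeanLogSU U c) ≤ (3∕2)·ρ`.  On the guard each loop variable is within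
`δ_N ≤ 1∕3` of `1`, so §2's linear form applies; off the guard `corr = 1`.  κ-END feeds `ρ := κ₀∕ℓ²` from (K1) (leaves κ-L1–L3). -/
theorem dist1_corr_le_three_halves_mul (U : GaugeField P j (Matrix.specialUnitaryGroup n ℂ)) (c : PBond P (j + 1)) {ρ : ℝ}
    (h : ∀ i, dist1 (loopHol U c i) ≤ ρ) : dist1 (corr (expMeanLogSU (n := n)) U c) ≤ 3 / 2 * ρ := by
  have hρ0 : 0 ≤ ρ := (GaugeGroup.dist1_nonneg _).trans (h (Classical.arbitrary (Idx P)))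
  refine dist1_corr_le_of_small_imp _ U c (by positivity) fun hs => ?_
  exact dist1_avg_le_three_halves_mul _ hs h

/-- [folklore] (K3) at the step in SCALED currency: `∀ c i, dist1 (loopHol U c i) ≤ κ₀∕ℓ²` ⟹ `∀ c, dist1 (corr expMeanLogSU U c) ≤ (3∕2·κ₀)∕ℓ²`
(any real `ℓ`; the division is Lean's total one). -/
theorem dist1_corr_scaled_le (U : GaugeField P j (Matrix.specialUnitaryGroup n ℂ)) {κ₀ ℓ : ℝ}
    (h : ∀ (c : PBond P (j + 1)) (i : Idx P), dist1 (loopHol U c i) ≤ κ₀ / ℓ ^ 2) (c : PBond P (j + 1)) :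
    dist1 (corr (expMeanLogSU (n := n)) U c) ≤ (3 / 2 * κ₀) / ℓ ^ 2 := by
  rw [mul_div_assoc]
  exact dist1_corr_le_three_halves_mul U c (h c)

end Block

/-! ## §4 In the display shape of the substrate's W-25b letter `hκ` (one `exact` for κ-END) -/

section Tower

open scoped Matrix.Norms.L2Operator
open Literature.MathematicalPhysics.QuantumFieldTheory.Balaban1983to89.BlockAveraging (Idx loopHol corr)
open Summit.QuantumFields.BalabanUV.T4Continuum.SubstrateAvgTowerStructure (avgTower)

variable {P : Params} {n : Type*} [Fintype n] [DecidableEq n] [Nonempty n]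

/-- [folklore] **κ-L4 IN W-25b's CURRENCY**: along the averaging tower `U_i = (blockAvg expMeanLogSU)^i V` of a finest configuration `V`, a loop-variable
bound `dist1 (loopHol U_i c idx) ≤ κ₀∕(L^(K−1−i))²` at every level `i < K` ((K1), leaves κ-L1–L3 + κ-END's induction) gives the substrate's displayed
letter `hκ : ∀ i < K, ∀ c, dist1 (corr ℰ U_i c) ≤ κ∕(L^(K−1−i))²` (`SubstrateAvgTowerStructure.dist1_corrAcc_le_of_hκ`) for `ℰ = expMeanLogSU` with
`κ := 3∕2·κ₀` — no threshold on `κ₀`, no condition on `L`. -/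
theorem hκ_of_loopHol_le (V : GaugeField P 0 (Matrix.specialUnitaryGroup n ℂ)) {κ₀ : ℝ}
    (hloop : ∀ i < P.K, ∀ (c : PBond P (i + 1)) (idx : Idx P),
      dist1 (loopHol (avgTower (expMeanLogSU (n := n)) V i) c idx) ≤ κ₀ / ((P.L : ℝ) ^ (P.K - 1 - i)) ^ 2) :
    ∀ i < P.K, ∀ c : PBond P (i + 1),
      dist1 (corr (expMeanLogSU (n := n)) (avgTower (expMeanLogSU (n := n)) V i) c) ≤ (3 / 2 * κ₀) / ((P.L : ℝ) ^ (P.K - 1 - i)) ^ 2 :=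
  fun i hi c => dist1_corr_scaled_le _ (hloop i hi) c

end Tower

end Summit.QuantumFields.BalabanUV.T4Continuum.B13AvgCorrEml

end
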